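import Literature.Analysis.FluidPDE.TorusVorticityTensorTransport
import Literature.Analysis.FluidPDE.PassiveScalarClassicalEntropy
import HarnessLib

/-!
# Planar Navier–Stokes on `T²`: the vorticity is a classical passive scalar of its own velocity,
# so viscosity never increases the co-signed flux `∫ ω⁺`

Topic `Literature/Analysis/FluidPDE` (theorems only; no definitions, no named facts). For a
classical solution `(u, p)` of the forced incompressible Navier–Stokes system on `T² × [a, b]`
(`Torus.IsClassicalNSSolutionOn (Icc a b) ν f u p` over `UnitAddTorus (Fin 2)`) whose force has
vanishing scalar curl (`∂₀f₁ = ∂₁f₀`, e.g. `f = 0` or a gradient), the scalar vorticity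
`ω = ∂₀u₁ − ∂₁u₀` — the entry `W₀₁` of the tree's vorticity tensor `torusVorticityTensor`
(`TorusVorticityTensorTransport.lean`) — satisfies

* `Torus.IsClassicalNSSolutionOn.isClassicalScalarTransportOn_planarVorticity` — **Majda–Bertozzi
  2002, (2.6) on the torus**: `ω` is a classical solution of the passive-scalar equation
  `∂ₜω + u·∇ω = νΔω` driven by its own (divergence-free) velocity, i.e.
  `Torus.IsClassicalScalarTransportOn (Icc a b) ν u ω` ("for 2D flows … the vorticity-stretching
  term vanishes, `ω·∇v ≡ 0` … vorticity equation (2.5) reduces to the scalar vorticity equation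
  `Dω/Dt = νΔω`", held text p. 43; the tree has the `ℝ²` form as
  `IsClassicalNSSolutionOn.planarVorticity_eq`, `PlanarVorticityTransport.lean`). Proof: the
  `(0,1)` entry of the vorticity-tensor transport identity
  `Torus.IsClassicalNSSolutionOn.timeDerivWithin_torusVorticityTensor` (MB (1.31)); in two
  dimensions its stretching term is `(∑ₖ ∂₀uₖ∂ₖu₁ − ∑ₖ ∂₁uₖ∂ₖu₀) = (div u) ω = 0`;
* hence, by the convex Lyapunov functionals of classical passive scalars
  (`PassiveScalarClassicalEntropy.lean`; Gallay–Wayne 2005, Lemma 3.1), for `ν ≥ 0`: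
  `…antitoneOn_integral_posPart_planarVorticity` — **the co-signed flux `∫_{T²} ω(t)⁺` is
  non-increasing**; `…antitoneOn_integral_negPart_planarVorticity`,
  `…antitoneOn_integral_abs_planarVorticity` (`∫ ω⁻`, `∫ |ω|` non-increasing) and
  `…antitoneOn_integral_comp_planarVorticity` (`∫ β(ω)` for any smooth convex `β`).

Reading (census «H_ν» of the cell `ns-blowup`, (iii) theorem side): in two dimensions viscosity and
incompressible transport can only cancel positive against negative vorticity — the total
co-signed circulation `∫ ω⁺` never grows, so single-structure flux can rise only by pooling
(merging) of already co-signed vorticity, bounded by the initial co-signed supply. Nothing is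
claimed in three dimensions, where the stretching term has no sign.

## References

* A. J. Majda, A. L. Bertozzi, *Vorticity and Incompressible Flow*, CUP (2002), §2.1 eqs.
  (2.5)–(2.6) (held text p. 43) and §3.? p. 105 ("for 2D flows vorticity equation (3.81) reduces
  to the scalar equation `ωₜ + v·∇ω = νΔω`"). [`MajdaBertozziCUP2002`]
* Th. Gallay, C. E. Wayne, Comm. Math. Phys. 255 (2005) = arXiv:math/0402449, Prop. 2.6 and
  Lemma 3.1. [`GallayWayne2005`]
-/

noncomputable section

open Set MeasureTheory Finset
open scoped ContDiff InnerProductSpace RealInnerProductSpace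

namespace Literature.Analysis.FunctionSpaces.Torus.IsClassicalNSSolutionOn

open Literature.Analysis.FluidPDE Literature.Analysis.FunctionSpaces

variable {a b ν : ℝ} {f u : ℝ → UnitAddTorus (Fin 2) → EuclideanSpace ℝ (Fin 2)}
  {p : ℝ → UnitAddTorus (Fin 2) → ℝ}

/-- **Majda–Bertozzi 2002, (2.6), on the torus: planar vorticity is a passive scalar of its own
velocity.** For a classical solution of forced Navier–Stokes on `T² × [a, b]` (`a < b`) whose
force has vanishing scalar curl, `∂₀f₁ = ∂₁f₀` on `[a, b] × T²`, the scalar vorticity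
`ω(t, x) = (∂₀u)₁ − (∂₁u)₀ = torusVorticityTensor (u t) 0 1 x` is a classical solution of
`∂ₜω + ⟪u, ∇ω⟫ = νΔω` with the divergence-free drift `u` (the `(0,1)` entry of the vorticity-tensor
transport identity; in two dimensions the stretching term equals `(div u) ω = 0`). [cite: MajdaBertozziCUP2002, §2.1 eq. (2.6)] -/
theorem isClassicalScalarTransportOn_planarVorticity (h : Torus.IsClassicalNSSolutionOn (Icc a b) ν f u p)
    (hab : a < b)
    (hf : ∀ t ∈ Icc a b, ∀ x, Torus.partialDeriv 0 (f t) x 1 = Torus.partialDeriv 1 (f t) x 0) :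
    Torus.IsClassicalScalarTransportOn (Icc a b) ν u
      (fun t x => torusVorticityTensor (u t) 0 1 x) := by
  have hU : UniqueDiffOn ℝ (Icc a b) := uniqueDiffOn_Icc hab
  have hWst : Torus.IsSmoothSpaceTimeOn (Icc a b) (fun t x => torusVorticityTensor (u t) 0 1 x) :=
    ((h.smooth_velocity.partialDeriv hU 0).apply 1).sub ((h.smooth_velocity.partialDeriv hU 1).apply 0)
  refine ⟨h.smooth_velocity, hWst, fun t ht x => ?_, h.divFree⟩
  have key := h.timeDerivWithin_torusVorticityTensor hab ht 0 1 x
  have hut : Torus.IsSmooth (u t) := h.smooth_velocity.isSmooth_slice ht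
  have hu1 : Torus.IsContDiff 1 (u t) := hut.isContDiff (by decide)
  have hW : Torus.IsSmooth (fun x => torusVorticityTensor (u t) 0 1 x) := hWst.isSmooth_slice ht
  have hconv := Torus.inner_gradient_eq_sum_mul_partialDeriv (hW.isContDiff (by decide)) (u t x) x
  have hdiv : Torus.partialDeriv 0 (u t) x 0 + Torus.partialDeriv 1 (u t) x 1 = 0 := by
    have h0 := h.divFree t ht x
    rw [Torus.divergence_eq_sum_partialDeriv_apply hu1, Fin.sum_univ_two] at h0
    exact h0
  simp only [Fin.sum_univ_two] at key hconv
  have eW : (fun x => torusVorticityTensor (u t) 0 1 x) = torusVorticityTensor (u t) 0 1 := rfl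
  rw [hconv, eW, key, hf t ht x]
  unfold torusVorticityTensor
  linear_combination (Torus.partialDeriv 1 (u t) x 0 - Torus.partialDeriv 0 (u t) x 1) * hdiv

/-- **Viscosity never increases the co-signed flux of planar vorticity.** For a classical solution
of Navier–Stokes on `T² × [a, b]` with `ν ≥ 0` and curl-free force, `t ↦ ∫_{T²} ω(t, x)⁺ dx` is
non-increasing on `[a, b]` (`ω` is a passive scalar of its own velocity, MB (2.6), and the
co-signed mass of a classical passive scalar is non-increasing — Gallay–Wayne 2005, Prop. 2.6 with
the proof of Lemma 3.1; tree `IsClassicalScalarTransportOn.antitoneOn_integral_posPart`). [cite: GallayWayne2005, Lemma 3.1] -/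
theorem antitoneOn_integral_posPart_planarVorticity (h : Torus.IsClassicalNSSolutionOn (Icc a b) ν f u p)
    (hab : a < b) (hν : 0 ≤ ν)
    (hf : ∀ t ∈ Icc a b, ∀ x, Torus.partialDeriv 0 (f t) x 1 = Torus.partialDeriv 1 (f t) x 0) :
    AntitoneOn (fun t => ∫ x, (torusVorticityTensor (u t) 0 1 x)⁺) (Icc a b) :=
  (h.isClassicalScalarTransportOn_planarVorticity hab hf).antitoneOn_integral_posPart hν Subset.rfl

/-- The counter-signed flux `∫_{T²} ω(t)⁻` of planar vorticity is non-increasing as well (`ν ≥ 0`,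
curl-free force). [cite: GallayWayne2005, Lemma 3.1] -/
theorem antitoneOn_integral_negPart_planarVorticity (h : Torus.IsClassicalNSSolutionOn (Icc a b) ν f u p)
    (hab : a < b) (hν : 0 ≤ ν)
    (hf : ∀ t ∈ Icc a b, ∀ x, Torus.partialDeriv 0 (f t) x 1 = Torus.partialDeriv 1 (f t) x 0) :
    AntitoneOn (fun t => ∫ x, (torusVorticityTensor (u t) 0 1 x)⁻) (Icc a b) :=
  (h.isClassicalScalarTransportOn_planarVorticity hab hf).antitoneOn_integral_negPart hν Subset.rfl

/-- **The `L¹` norm of planar vorticity `∫_{T²} |ω(t)|` is non-increasing** (`ν ≥ 0`, curl-free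
force): Gallay–Wayne 2005, Lemma 3.1 ("the `L¹` norm is nonincreasing due to the maximum
principle"), there on `ℝ²`, here its periodic classical form. [cite: GallayWayne2005, Lemma 3.1] -/
theorem antitoneOn_integral_abs_planarVorticity (h : Torus.IsClassicalNSSolutionOn (Icc a b) ν f u p)
    (hab : a < b) (hν : 0 ≤ ν)
    (hf : ∀ t ∈ Icc a b, ∀ x, Torus.partialDeriv 0 (f t) x 1 = Torus.partialDeriv 1 (f t) x 0) :
    AntitoneOn (fun t => ∫ x, |torusVorticityTensor (u t) 0 1 x|) (Icc a b) :=
  (h.isClassicalScalarTransportOn_planarVorticity hab hf).antitoneOn_integral_abs hν Subset.rfl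

/-- Every smooth convex functional `∫_{T²} β(ω(t))` of planar vorticity is non-increasing (`ν ≥ 0`,
curl-free force; `β` smooth with `β″ ≥ 0` — e.g. the enstrophy `β(s) = s²`): the renormalised
balance `d/dt ∫ β(ω) = −ν ∫ β″(ω)‖∇ω‖²` of the passive scalar `ω` (DiPerna–Lions 1989 §II.3,
classical case). [cite: DiPernaLions1989, §II.3] -/
theorem antitoneOn_integral_comp_planarVorticity (h : Torus.IsClassicalNSSolutionOn (Icc a b) ν f u p)
    (hab : a < b) (hν : 0 ≤ ν)
    (hf : ∀ t ∈ Icc a b, ∀ x, Torus.partialDeriv 0 (f t) x 1 = Torus.partialDeriv 1 (f t) x 0)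
    {β : ℝ → ℝ} (hβ : ContDiff ℝ ∞ β) (hβ'' : ∀ s, 0 ≤ deriv (deriv β) s) :
    AntitoneOn (fun t => ∫ x, β (torusVorticityTensor (u t) 0 1 x)) (Icc a b) :=
  (h.isClassicalScalarTransportOn_planarVorticity hab hf).antitoneOn_integral_comp hν hβ hβ'' Subset.rfl

end Literature.Analysis.FunctionSpaces.Torus.IsClassicalNSSolutionOn
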